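import Summits.HubbardSuperconductivity.HubbardSuperconductivity.Theorems.BirComplexStableXY.Negative.BirComplexStableXYFalseOfWitnessZeroExists

/-!
# Route BalabanIR — support item `BirGappedPhaseReduction` (stmt-HubbardSuperconductivity-2082) closed MODULO `WitnessZeroExists`

`BirGappedPhaseReduction := BirComplexStableXY → BirGroundStateAverageLRO` is glue over the rev-0 engine
(`¬ item ↔ engine ∧ ¬ target`, `Theorems.not_birGappedPhaseReduction_iff`).  The engine's negative lane
(`Theorems/BirComplexStableXY/Negative/`) proves `WitnessZeroExists → ¬ BirComplexStableXY`
(`BirComplexStableXY_false_of_WitnessZeroExists`: the witness table is admissible with `r = 2, B = 128,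
c₀ = 1/18`; a zero of the crux's own `Z` for it contradicts conjunct 1).  Composing with ex falso gives the
item modulo the SAME hypothesis `H = WitnessZeroExists` (Beraha–Kahane–Weiss zeros of `Z = Tr T^M` at
`M ~ K²L⁴` for the witness family, beyond every size threshold `L₀` — the analytic heart, not constructible
in the tree today): the construction item for `H` therefore settles stmt-2080 (refuted) AND stmt-2082
(proved, vacuously) at once.  This file is bookkeeping (`--supports stmt-HubbardSuperconductivity-2082`);
it imports `Theses.BalabanIR` transitively and is NOT a closing module (a closing module must state the
item's body structurally, Theses-free — see the route's materialisation rule).  No definition is introduced.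
-/

namespace Summit.HubbardSuperconductivity.HubbardSuperconductivity.Theorems

open Summit.HubbardSuperconductivity.HubbardSuperconductivity.Theses.BalabanIR
open Summit.HubbardSuperconductivity.BirComplexStableXYNegative

/-- `BirGappedPhaseReduction` (stmt-HubbardSuperconductivity-2082) holds modulo `WitnessZeroExists`:
zeros of the engine's partition function for the admissible witness family refute the antecedent
`BirComplexStableXY`, so the implication holds vacuously. [folklore; composition of
`BirComplexStableXY_false_of_WitnessZeroExists` with ex falso] -/
theorem birGappedPhaseReduction_of_witnessZeroExists (hW : WitnessZeroExists) :
    BirGappedPhaseReduction :=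
  fun hE => absurd hE (BirComplexStableXY_false_of_WitnessZeroExists hW)

/-- Equivalently: under `WitnessZeroExists` the pair (stmt-2080, stmt-2082) is settled together —
the engine is false and the rev-0 reduction is true. [folklore] -/
theorem not_engine_and_reduction_of_witnessZeroExists (hW : WitnessZeroExists) :
    ¬ BirComplexStableXY ∧ BirGappedPhaseReduction :=
  ⟨BirComplexStableXY_false_of_WitnessZeroExists hW, birGappedPhaseReduction_of_witnessZeroExists hW⟩

end Summit.HubbardSuperconductivity.HubbardSuperconductivity.Theorems
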